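import Literature.Computability.QuantumComplexity.BlockKit
import HarnessLib

/-!
# A gadget kit for an arbitrary extra program list inside a block of data wires

Topic `Literature/Computability/QuantumComplexity`, the generic form of `BlockKit.lean` (the AJL kit) and
`QFTKit.lean` (the Fourier kit): for a list `ps` of flag programs, `dsz` data wires and `k` averaging
bits we lay out a block of `GenKit.bsize ps dsz k` wires — the `dsz` data wires, the dummy, the
selector, `k` averaging wires, the reflection helpers, then the classical region sized for BOTH the AJL
letter programs (so that `GadgetKit.OK` holds and every kit lemma of `LetterWord.lean` applies) and the
programs of `ps` (`GenKit.gR/gF/gT`: maxima) — and prove the kit well formed (`GenKit.kit_ok`), the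
bounds of the extra programs (`GenKit.bounds_of_mem`) and the position facts of the data wires
(`GenKit.dataEmb`, `data_facts`). Used by the Grover–Rudolph block of Regev's sampler (programs
`[GRWord.prog k]`, data = point register and work window).

Everything here is proved; definitions have bodies; no named fact is introduced.

## References

* O. Regev, *On lattices, learning with errors, random linear codes, and cryptography*, J. ACM 56
  (2009), art. 34, Lemma 3.12 (proof), Lemma 3.14 (proof) [Regev2009].
* M. A. Nielsen, I. L. Chuang, *Quantum Computation and Quantum Information*, CUP 2010, §3.2.5
  (ancilla bookkeeping) [NielsenChuang2010].
-/

namespace Literature.Computability.QuantumComplexity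

open Cryptography RevSim



namespace GenKit

open BlockKit (lmax le_lmax)

/-! ### Sizes -/

/-- Registers needed by the extra programs. [folklore] -/
noncomputable def psR (ps : List SLP.BExpr) (k : ℕ) : ℕ := lmax (ps.map fun b => (b.compile (SLP.thrWd k) 0 0).2.2.1)

/-- Flags needed by the extra programs. [folklore] -/
noncomputable def psF (ps : List SLP.BExpr) (k : ℕ) : ℕ := lmax (ps.map fun b => (b.compile (SLP.thrWd k) 0 0).2.2.2)

/-- Instruction slots needed by the extra programs. [folklore] -/
noncomputable def psT (ps : List SLP.BExpr) (k : ℕ) : ℕ := lmax (ps.map fun b => (b.compile (SLP.thrWd k) 0 0).1.length)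

/-- Registers of the kit: enough for both program families. [folklore] -/
noncomputable def gR (ps : List SLP.BExpr) (k : ℕ) : ℕ := max (BlockKit.kitR k) (psR ps k)

/-- Flags of the kit. [folklore] -/
noncomputable def gF (ps : List SLP.BExpr) (k : ℕ) : ℕ := max (BlockKit.kitF k) (psF ps k)

/-- Instruction slots of the kit. [folklore] -/
noncomputable def gT (ps : List SLP.BExpr) (k : ℕ) : ℕ := max (BlockKit.kitT k) (psT ps k)

/-- The register bound dominates the extra programs. [folklore] -/
theorem le_gR {ps : List SLP.BExpr} {k : ℕ} {b : SLP.BExpr} (hb : b ∈ ps) : (b.compile (SLP.thrWd k) 0 0).2.2.1 ≤ gR ps k := by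
  have h : (b.compile (SLP.thrWd k) 0 0).2.2.1 ≤ psR ps k := le_lmax (List.mem_map.2 ⟨b, hb, rfl⟩)
  exact h.trans (le_max_right _ _)

/-- The flag bound dominates the extra programs. [folklore] -/
theorem le_gF {ps : List SLP.BExpr} {k : ℕ} {b : SLP.BExpr} (hb : b ∈ ps) : (b.compile (SLP.thrWd k) 0 0).2.2.2 ≤ gF ps k := by
  have h : (b.compile (SLP.thrWd k) 0 0).2.2.2 ≤ psF ps k := le_lmax (List.mem_map.2 ⟨b, hb, rfl⟩)
  exact h.trans (le_max_right _ _)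

/-- The slot bound dominates the extra programs. [folklore] -/
theorem le_gT {ps : List SLP.BExpr} {k : ℕ} {b : SLP.BExpr} (hb : b ∈ ps) : (b.compile (SLP.thrWd k) 0 0).1.length ≤ gT ps k := by
  have h : (b.compile (SLP.thrWd k) 0 0).1.length ≤ psT ps k := le_lmax (List.mem_map.2 ⟨b, hb, rfl⟩)
  exact h.trans (le_max_right _ _)

-- the bounds are data for the layout only: never unfold them again
attribute [irreducible] psR psF psT

/-- The size of the classical region. [folklore] -/
noncomputable def regionSize (ps : List SLP.BExpr) (k : ℕ) : ℕ := gR ps k * SLP.thrWd k + gF ps k + gT ps k * SLP.scrSize (SLP.thrWd k)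

/-- Offset of the dummy wire: after the `dsz` data wires. [folklore] -/
def dataOff (dsz : ℕ) : ℕ := dsz

/-- Base of the register block: after dummy, `cr`, `k` averaging wires and `k + regionSize` helpers. [folklore] -/
noncomputable def rb (ps : List SLP.BExpr) (dsz k : ℕ) : ℕ := dataOff dsz + 2 + k + (k + regionSize ps k)

/-- The block size. [folklore] -/
noncomputable def bsize (ps : List SLP.BExpr) (dsz k : ℕ) : ℕ := rb ps dsz k + regionSize ps k

/-- Blocks are nonempty. [folklore] -/
theorem bsize_pos (ps : List SLP.BExpr) (dsz k : ℕ) : 0 < bsize ps dsz k := by unfold bsize rb dataOff; omega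

variable (ps : List SLP.BExpr) (dsz k : ℕ)

/-- Wire number `v` of the block. [folklore] -/
noncomputable def wire (v : ℕ) : Fin (bsize ps dsz k) := finOf (bsize ps dsz k) (bsize_pos ps dsz k) v

/-- `wire v` has value `v` below the block size. [folklore] -/
theorem wire_val {v : ℕ} (hv : v < bsize ps dsz k) : (wire ps dsz k v : ℕ) = v := by rw [wire, finOf_of_lt _ hv]

/-- `wire` is injective below the block size. [folklore] -/
theorem wire_inj {v v' : ℕ} (hv : v < bsize ps dsz k) (hv' : v' < bsize ps dsz k) (h : wire ps dsz k v = wire ps dsz k v') : v = v' := by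
  have := congrArg Fin.val h; rwa [wire_val ps dsz k hv, wire_val ps dsz k hv'] at this

/-! ### The kit -/

/-- **The gadget kit of the block.** [folklore] -/
noncomputable def kit : GadgetKit (bsize ps dsz k) where
  hN := bsize_pos ps dsz k
  k := k
  as := (List.range k).map fun j => wire ps dsz k (dataOff dsz + 2 + j)
  cr := wire ps dsz k (dataOff dsz + 1)
  rb := rb ps dsz k
  fb := rb ps dsz k + gR ps k * SLP.thrWd k
  sb := rb ps dsz k + gR ps k * SLP.thrWd k + gF ps k
  R := gR ps k
  F := gF ps k
  T := gT ps k
  hs := (List.range (k + regionSize ps k)).map fun j => wire ps dsz k (dataOff dsz + 2 + k + j)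
  d0 := wire ps dsz k (dataOff dsz)

/-- The fields of the kit (definitional). [folklore] -/
theorem kit_as : (kit ps dsz k).as = (List.range k).map fun j => wire ps dsz k (dataOff dsz + 2 + j) := rfl
/-- The fields of the kit (definitional). [folklore] -/
theorem kit_cr : (kit ps dsz k).cr = wire ps dsz k (dataOff dsz + 1) := rfl
/-- The fields of the kit (definitional). [folklore] -/
theorem kit_hs : (kit ps dsz k).hs = (List.range (k + regionSize ps k)).map fun j => wire ps dsz k (dataOff dsz + 2 + k + j) := rfl
/-- The fields of the kit (definitional). [folklore] -/
theorem kit_d0 : (kit ps dsz k).d0 = wire ps dsz k (dataOff dsz) := rfl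
/-- The fields of the kit (definitional). [folklore] -/
theorem kit_rb : (kit ps dsz k).rb = rb ps dsz k := rfl
/-- The fields of the kit (definitional). [folklore] -/
theorem kit_k : (kit ps dsz k).k = k := rfl
/-- The fields of the kit (definitional). [folklore] -/
theorem kit_fb : (kit ps dsz k).fb = rb ps dsz k + gR ps k * SLP.thrWd k := rfl
/-- The fields of the kit (definitional). [folklore] -/
theorem kit_sb : (kit ps dsz k).sb = rb ps dsz k + gR ps k * SLP.thrWd k + gF ps k := rfl
/-- The fields of the kit (definitional). [folklore] -/
theorem kit_T : (kit ps dsz k).T = gT ps k := rfl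
/-- The fields of the kit (definitional). [folklore] -/
theorem kit_R : (kit ps dsz k).R = gR ps k := rfl
/-- The fields of the kit (definitional). [folklore] -/
theorem kit_F : (kit ps dsz k).F = gF ps k := rfl

/-- The region of the kit has `regionSize` wires. [folklore] -/
theorem length_region : (kit ps dsz k).region.length = regionSize ps k := by
  rw [GadgetKit.region, layoutRegion, List.length_map, List.length_append, List.length_append, List.length_map, List.length_map,
    List.length_map, List.length_range, List.length_range, List.length_range]
  rfl

/-- **The kit of the block is well formed** (for `k ≥ 1`). [folklore] -/
theorem kit_ok (hk : 1 ≤ k) : (kit ps dsz k).OK := by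
  have hrb : rb ps dsz k = dataOff dsz + 2 + k + (k + regionSize ps k) := rfl
  have hb : bsize ps dsz k = rb ps dsz k + regionSize ps k := rfl
  refine
    { len := by rw [kit_as, List.length_map, List.length_range]; rfl
      nodup := ?_
      had_lt := ?_
      d0_lt := by rw [kit_d0, kit_rb, wire_val ps dsz k (by omega)]; omega
      d0_notin := ?_
      fb_ge := le_rfl
      sb_ge := le_rfl
      top_le := by rw [kit_sb, kit_T, show (kit ps dsz k).Wd = SLP.thrWd k from rfl, hb, regionSize]; omega
      hs_len := by rw [List.length_append, length_region, kit_as, kit_hs, List.length_map, List.length_map, List.length_range, List.length_range]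
      hs_ne := by rw [kit_hs]; intro h; have := congrArg List.length h; rw [List.length_map, List.length_range] at this; simp at this; omega
      hs_nodup := ?_
      hs_low := ?_
      hs_had := ?_
      hs_d0 := ?_
      R_ge := fun b hb' => (BlockKit.le_kitR hb').trans (le_max_left _ _)
      F_ge := fun b hb' => (BlockKit.le_kitF hb').trans (le_max_left _ _)
      T_ge := fun b hb' => (BlockKit.le_kitT hb').trans (le_max_left _ _) }
  · -- nodup (cr :: as)
    rw [kit_cr, kit_as, List.nodup_cons]
    refine ⟨fun h => ?_, ?_⟩
    · rw [List.mem_map] at h; obtain ⟨j, hj, h⟩ := h; rw [List.mem_range] at hj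
      have := wire_inj ps dsz k (by omega) (by omega) h; omega
    · refine List.nodup_range.map_on fun j hj j' hj' h => ?_
      rw [List.mem_range] at hj hj'
      have := wire_inj ps dsz k (by omega) (by omega) h; omega
  · -- had_lt
    intro a ha
    rw [kit_cr, kit_as, List.mem_cons, List.mem_map] at ha
    rw [kit_rb]
    rcases ha with rfl | ⟨j, hj, rfl⟩
    · rw [wire_val ps dsz k (by omega)]; omega
    · rw [List.mem_range] at hj; rw [wire_val ps dsz k (by omega)]; omega
  · -- d0_notin
    rw [kit_d0, kit_cr, kit_as, List.mem_cons, List.mem_map, not_or]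
    refine ⟨fun h => ?_, ?_⟩
    · have := wire_inj ps dsz k (by omega) (by omega) h; omega
    · rintro ⟨j, hj, h⟩; rw [List.mem_range] at hj
      have := wire_inj ps dsz k (by omega) (by omega) h; omega
  · -- hs_nodup
    rw [kit_hs]
    refine List.nodup_range.map_on fun j hj j' hj' h => ?_
    rw [List.mem_range] at hj hj'
    have := wire_inj ps dsz k (by omega) (by omega) h; omega
  · -- hs_low
    intro h hh
    rw [kit_hs, List.mem_map] at hh
    obtain ⟨j, hj, rfl⟩ := hh
    rw [List.mem_range] at hj
    rw [kit_rb, wire_val ps dsz k (by omega)]; omega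
  · -- hs_had
    intro h hh hmem
    rw [kit_hs, List.mem_map] at hh
    obtain ⟨j, hj, rfl⟩ := hh
    rw [List.mem_range] at hj
    rw [kit_cr, kit_as, List.mem_cons, List.mem_map] at hmem
    rcases hmem with h1 | ⟨j', hj', h2⟩
    · have := wire_inj ps dsz k (by omega) (by omega) h1; omega
    · rw [List.mem_range] at hj'
      have := wire_inj ps dsz k (by omega) (by omega) h2.symm; omega
  · -- hs_d0
    rw [kit_d0, kit_hs, List.mem_map]
    rintro ⟨j, hj, h⟩
    rw [List.mem_range] at hj
    have := wire_inj ps dsz k (by omega) (by omega) h; omega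

/-- The bounds of the kit dominate the extra programs. [folklore] -/
theorem bounds_of_mem {b : SLP.BExpr} (hb : b ∈ ps) :
    (b.compile (kit ps dsz k).Wd 0 0).2.2.1 ≤ (kit ps dsz k).R ∧ (b.compile (kit ps dsz k).Wd 0 0).2.2.2 ≤ (kit ps dsz k).F ∧
      (b.compile (kit ps dsz k).Wd 0 0).1.length ≤ (kit ps dsz k).T :=
  ⟨le_gR hb, le_gF hb, le_gT hb⟩

/-- **The data wires**: wire `j < dsz` of the block. [folklore] -/
noncomputable def dataWire (j : Fin dsz) : Fin (bsize ps dsz k) := wire ps dsz k j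

/-- The data wires as an embedding. [folklore] -/
noncomputable def dataEmb : Fin dsz ↪ Fin (bsize ps dsz k) :=
  ⟨dataWire ps dsz k, fun j j' h => Fin.ext (wire_inj ps dsz k (by unfold bsize rb dataOff; omega) (by unfold bsize rb dataOff; omega) h)⟩

/-- The value of a data wire. [folklore] -/
theorem dataEmb_val (j : Fin dsz) : (dataEmb ps dsz k j : ℕ) = j := wire_val ps dsz k (by unfold bsize rb dataOff; omega)

/-- **Position facts of the data wires**: below the register base, not the dummy, not a Hadamard wire,
not a helper. [folklore] -/
theorem data_facts (j : Fin dsz) :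
    (dataEmb ps dsz k j : ℕ) < (kit ps dsz k).rb ∧ dataEmb ps dsz k j ≠ (kit ps dsz k).d0 ∧ dataEmb ps dsz k j ∉ (kit ps dsz k).cr :: (kit ps dsz k).as ∧
      dataEmb ps dsz k j ∉ (kit ps dsz k).hs := by
  have hv := dataEmb_val ps dsz k j
  have hj : (j : ℕ) < dsz := j.2
  have hb : bsize ps dsz k = dsz + 2 + k + (k + regionSize ps k) + regionSize ps k := rfl
  refine ⟨?_, ?_, ?_, ?_⟩
  · rw [kit_rb, hv]; unfold rb dataOff; omega
  · intro h
    have := congrArg Fin.val h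
    rw [hv, kit_d0, wire_val ps dsz k (by unfold dataOff; omega)] at this
    unfold dataOff at this; omega
  · rw [kit_cr, kit_as, List.mem_cons, List.mem_map, not_or]
    refine ⟨fun h => ?_, ?_⟩
    · have := congrArg Fin.val h
      rw [hv, wire_val ps dsz k (by unfold dataOff; omega)] at this
      unfold dataOff at this; omega
    · rintro ⟨i, hi, h⟩; rw [List.mem_range] at hi
      have := congrArg Fin.val h
      rw [hv, wire_val ps dsz k (by unfold dataOff; omega)] at this
      unfold dataOff at this; omega
  · rw [kit_hs, List.mem_map]
    rintro ⟨i, hi, h⟩; rw [List.mem_range] at hi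
    have := congrArg Fin.val h
    rw [hv, wire_val ps dsz k (by unfold dataOff; omega)] at this
    unfold dataOff at this; omega

end GenKit

end Literature.Computability.QuantumComplexity
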